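import Summits.ValiantsHypothesis.ValiantsHypothesis.Theorems.ValuativeGCTValuativeBoundNegativeStabTorus

/-!
# `ValuativeBound` (stmt-ValiantsHypothesis-12625), negative side VII-b: the valuative cut is BLIND on
compression spaces — for every `m`, every `δ`, every weight (cdisprove, cycle 3)

For a coordinate compression space `U = blockSpace R C = {u : u_{ab} = 0 for a ∈ R, b ∈ C}` (all of
whose members have rank `≤ 2m - |R| - |C|`, `rank_le_of_mem_blockSpace`), the crux's valuative
clause `G ∈ I(L_U)^(δ(m-r))`, `r = 2m - |R| - |C|`, is IMPLIED by the degree and Stab clauses: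
`truncation_blockSpace_eq_symTruncation : T_U(λ) = Hom_(mδ) ⊓ Stab ⊓ Borel_λ*` (no vanishing
condition at all), i.e. at compression spaces the crux is EXACTLY the symmetric (Kronecker-type)
bound and carries no new information (`valuativeBound_at_blockSpace_iff`); only non-compression
singular spaces (`Λ₃ ⊂ M₃`, …, which exist from `m = 3` on) can make the cut bite.  Every
compression space is `P·(blockSpace R C)·Q` and the symmetric truncation is `Stab`-invariant, so the
coordinate case is the general one (remark; not formalised here).
Mechanism: balance (`rowSlots_eq`, `colSlots_eq` of `…NegativeStabTorus`) and counting — at least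
`δ(|R| + |C| - m)` slots of every monomial lie in the block `R × C` (`le_blockSlots`), and block
variables vanish on `L_U` (`monomial_mem_pow_of_le_blockSlots`). [folklore]
-/

namespace Summit.ValiantsHypothesis.Theorems.ValuativeBoundNegative

open MvPolynomial
open Literature.NumberTheory.DiophantineGeometry Literature.Computability.AlgebraicComplexity

section CompressionBlind

variable {m : ℕ}

/-! ### Compression spaces and the block count -/

/-- The coordinate compression space: matrices vanishing on the block `R × C`. Every member has
rank `≤ (m - |R|) + (m - |C|)`. -/
def blockSpace (R C : Finset (Fin m)) : Submodule ℂ (MatIdx m → ℂ) where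
  carrier := {u | ∀ a ∈ R, ∀ b ∈ C, u (toLex (a, b)) = 0}
  add_mem' := by
    intro u v hu hv a ha b hb
    simp [hu a ha b hb, hv a ha b hb]
  zero_mem' := by
    intro a _ b _
    rfl
  smul_mem' := by
    intro c u hu a ha b hb
    simp [hu a ha b hb]

/-- Membership in `blockSpace`. -/
theorem mem_blockSpace_iff {R C : Finset (Fin m)} {u : MatIdx m → ℂ} :
    u ∈ blockSpace R C ↔ ∀ a ∈ R, ∀ b ∈ C, u (toLex (a, b)) = 0 := Iff.rfl

/-- Slots of `e` inside the block `R × C`. -/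
def blockSlots (R C : Finset (Fin m)) (e : MatIdx m × MatIdx m →₀ ℕ) : ℕ :=
  ∑ p ∈ Finset.univ.filter (fun p : MatIdx m × MatIdx m => (ofLex p.2).1 ∈ R ∧ (ofLex p.2).2 ∈ C), e p

/-- Arithmetic of the count. -/
theorem threshold_le_aux {δ Rc Cc m B rest : ℕ} (h1 : Rc * δ = B + rest) (h2 : rest ≤ (m - Cc) * δ)
    (hC : Cc ≤ m) : δ * (Rc + Cc - m) ≤ B := by
  obtain ⟨j, rfl⟩ := Nat.exists_eq_add_of_le hC
  rw [Nat.add_sub_cancel_left] at h2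
  by_cases h : Cc + j ≤ Rc + Cc
  · obtain ⟨k, hk⟩ := Nat.exists_eq_add_of_le h
    rw [hk, Nat.add_sub_cancel_left]
    have hR : Rc = j + k := by omega
    subst hR
    rw [add_mul] at h1
    rw [mul_comm]
    omega
  · rw [Nat.sub_eq_zero_of_le (by omega : Rc + Cc ≤ Cc + j), mul_zero]
    exact Nat.zero_le _

/-- **At least `δ(|R| + |C| - m)` slots of a balanced monomial lie in the block.** -/
theorem le_blockSlots {δ : ℕ} (R C : Finset (Fin m)) {e : MatIdx m × MatIdx m →₀ ℕ}
    (hrow : ∀ a, rowSlots a e = δ) (hcol : ∀ b, colSlots b e = δ) :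
    δ * (R.card + C.card - m) ≤ blockSlots R C e := by
  classical
  -- slots with row in R
  set SR := Finset.univ.filter (fun p : MatIdx m × MatIdx m => (ofLex p.2).1 ∈ R) with hSR
  have h1 : ∑ p ∈ SR, e p = R.card * δ := by
    rw [← Finset.sum_fiberwise_of_maps_to (s := SR) (t := R) (g := fun p => (ofLex p.2).1)
      (fun p hp => (Finset.mem_filter.mp hp).2)]
    rw [Finset.sum_congr rfl (fun a ha => ?_), Finset.sum_const, smul_eq_mul]
    rw [← hrow a, rowSlots]
    refine Finset.sum_congr ?_ fun _ _ => rfl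
    ext p
    simp only [hSR, Finset.mem_filter, Finset.mem_univ, true_and]
    exact ⟨fun h => h.2, fun h => ⟨h ▸ ha, h⟩⟩
  -- split by column in C
  have h2 : ∑ p ∈ SR, e p = blockSlots R C e + ∑ p ∈ SR.filter (fun p => ¬ (ofLex p.2).2 ∈ C), e p := by
    rw [← Finset.sum_filter_add_sum_filter_not SR (fun p => (ofLex p.2).2 ∈ C), blockSlots]
    congr 1
    refine Finset.sum_congr ?_ fun _ _ => rfl
    ext p
    simp [hSR, Finset.mem_filter]
  -- the rest is bounded by the slots in columns outside C
  have h3 : ∑ p ∈ SR.filter (fun p => ¬ (ofLex p.2).2 ∈ C), e p ≤ (m - C.card) * δ := by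
    have hsub : SR.filter (fun p => ¬ (ofLex p.2).2 ∈ C) ⊆
        Finset.univ.filter (fun p : MatIdx m × MatIdx m => (ofLex p.2).2 ∈ Cᶜ) := by
      intro p hp
      simp only [Finset.mem_filter, Finset.mem_univ, true_and, Finset.mem_compl] at hp ⊢
      exact hp.2
    refine (Finset.sum_le_sum_of_subset hsub).trans (le_of_eq ?_)
    rw [← Finset.sum_fiberwise_of_maps_to (s := Finset.univ.filter fun p : MatIdx m × MatIdx m => (ofLex p.2).2 ∈ Cᶜ)
      (t := Cᶜ) (g := fun p => (ofLex p.2).2) (fun p hp => (Finset.mem_filter.mp hp).2)]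
    rw [Finset.sum_congr rfl (fun b hb => ?_), Finset.sum_const, Finset.card_compl, Fintype.card_fin,
      smul_eq_mul]
    rw [← hcol b, colSlots]
    refine Finset.sum_congr ?_ fun _ _ => rfl
    ext p
    simp only [Finset.mem_filter, Finset.mem_univ, true_and]
    exact ⟨fun h => h.2, fun h => ⟨h ▸ hb, h⟩⟩
  exact threshold_le_aux (h1.symm.trans h2).symm.symm h3 (by simpa using C.card_le_univ)

/-- Block variables vanish on `L_U`, `U = blockSpace R C`. -/
theorem X_mem_vanishingIdeal_blockSpace {R C : Finset (Fin m)} {p : MatIdx m × MatIdx m}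
    (ha : (ofLex p.2).1 ∈ R) (hb : (ofLex p.2).2 ∈ C) :
    (X p : MvPolynomial (MatIdx m × MatIdx m) ℂ) ∈
      MvPolynomial.vanishingIdeal ℂ (rowLocus m (blockSpace R C)) := by
  rw [MvPolynomial.mem_vanishingIdeal_iff]
  intro A hA
  rw [aeval_X]
  have h := (mem_blockSpace_iff.mp (hA p.1)) (ofLex p.2).1 ha (ofLex p.2).2 hb
  simpa using h

/-- A monomial with `≥ t` block slots lies in `I(L_U)^t`. -/
theorem monomial_mem_pow_of_le_blockSlots {R C : Finset (Fin m)} {e : MatIdx m × MatIdx m →₀ ℕ} {t : ℕ}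
    (ht : t ≤ blockSlots R C e) (c : ℂ) :
    monomial e c ∈ (MvPolynomial.vanishingIdeal ℂ (rowLocus m (blockSpace R C))) ^ t := by
  classical
  have hmon : monomial e c = MvPolynomial.C c * ∏ p, (X p : MvPolynomial (MatIdx m × MatIdx m) ℂ) ^ e p := by
    rw [monomial_eq, Finsupp.prod_fintype _ _ (fun p => pow_zero _)]
  rw [hmon]
  apply Ideal.mul_mem_left
  rw [← Finset.prod_filter_mul_prod_filter_not Finset.univ
    (fun p : MatIdx m × MatIdx m => (ofLex p.2).1 ∈ R ∧ (ofLex p.2).2 ∈ C)]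
  apply Ideal.mul_mem_right
  apply Ideal.pow_le_pow_right ht
  rw [blockSlots, ← Finset.prod_pow_eq_pow_sum]
  exact Ideal.prod_mem_prod fun p hp =>
    Ideal.pow_mem_pow (X_mem_vanishingIdeal_blockSpace (Finset.mem_filter.mp hp).2.1
      (Finset.mem_filter.mp hp).2.2) _

/-- **Degree + Stab clauses imply the valuative clause at every compression space.** -/
theorem mem_vanishingIdeal_pow_blockSpace (R C : Finset (Fin m)) {δ : ℕ}
    {G : MvPolynomial (MatIdx m × MatIdx m) ℂ}
    (hH : G ∈ MvPolynomial.homogeneousSubmodule (MatIdx m × MatIdx m) ℂ (m * δ))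
    (hS : G ∈ stabInvariants m) :
    G ∈ (MvPolynomial.vanishingIdeal ℂ (rowLocus m (blockSpace R C))) ^ (δ * (R.card + C.card - m)) := by
  rw [G.as_sum]
  refine Ideal.sum_mem _ fun e he => monomial_mem_pow_of_le_blockSlots ?_ _
  exact le_blockSlots R C (rowSlots_eq hH hS he) (colSlots_eq hH hS he)

/-! ### The truncation at a compression space is the symmetric truncation -/

variable (m) in
/-- The SYMMETRIC truncation (no valuative clause): `Hom_n ⊓ Stab-invariants ⊓ B_χ-semi-invariants`. -/
noncomputable def symTruncation (n : ℕ) (χ : Weight (MatIdx m)) :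
    Submodule ℂ (MvPolynomial (MatIdx m × MatIdx m) ℂ) :=
  MvPolynomial.homogeneousSubmodule (MatIdx m × MatIdx m) ℂ n ⊓ stabInvariants m ⊓ borelSemiInvariants m χ

/-- Threshold `0` is no condition. -/
theorem truncation_zero_eq_symTruncation (L : Set (MatIdx m × MatIdx m → ℂ)) (n : ℕ) (χ : Weight (MatIdx m)) :
    truncation m L 0 n χ = symTruncation m n χ := by
  ext G
  rw [mem_truncation_iff, symTruncation, Submodule.mem_inf, Submodule.mem_inf, pow_zero, Ideal.one_eq_top]
  simp only [Submodule.mem_top, true_and, and_assoc]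

/-- **COMPRESSION BLINDNESS.** At `U = blockSpace R C` with the crux's threshold `δ(m - r)`,
`r = 2m - |R| - |C|` (so `m - r = |R| + |C| - m`), the valuative truncation IS the symmetric one:
the cut carries no information at any compression space, for every `m`, `δ` and weight. -/
theorem truncation_blockSpace_eq_symTruncation (R C : Finset (Fin m)) (δ : ℕ) (χ : Weight (MatIdx m)) :
    truncation m (rowLocus m (blockSpace R C)) (δ * (R.card + C.card - m)) (m * δ) χ = symTruncation m (m * δ) χ := by
  refine le_antisymm (fun G hG => ?_) (fun G hG => ?_)
  · rw [mem_truncation_iff] at hG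
    rw [symTruncation, Submodule.mem_inf, Submodule.mem_inf]
    exact ⟨⟨hG.1, hG.2.2.1⟩, hG.2.2.2⟩
  · rw [symTruncation, Submodule.mem_inf, Submodule.mem_inf] at hG
    rw [mem_truncation_iff]
    exact ⟨hG.1.1, mem_vanishingIdeal_pow_blockSpace R C hG.1.1 hG.1.2, hG.1.2, hG.2⟩

/-- The same with the threshold written as in the crux, `δ * (m - r)`, `r = 2m - |R| - |C|`. -/
theorem truncation_blockSpace_cruxThreshold (R C : Finset (Fin m)) (δ : ℕ) (χ : Weight (MatIdx m)) :
    truncation m (rowLocus m (blockSpace R C)) (δ * (m - (2 * m - R.card - C.card))) (m * δ) χ =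
      symTruncation m (m * δ) χ := by
  have hR : R.card ≤ m := by simpa using R.card_le_univ
  have hC : C.card ≤ m := by simpa using C.card_le_univ
  have : m - (2 * m - R.card - C.card) = R.card + C.card - m := by omega
  rw [this]
  exact truncation_blockSpace_eq_symTruncation R C δ χ

/-! ### `blockSpace R C` is admissible in the crux with `r = 2m - |R| - |C|` -/

/-- Subadditivity of the rank (via ranges). -/
theorem rank_add_le' (A B : Matrix (Fin m) (Fin m) ℂ) : (A + B).rank ≤ A.rank + B.rank := by
  unfold Matrix.rank
  rw [Matrix.mulVecLin_add]
  have hle : LinearMap.range (A.mulVecLin + B.mulVecLin) ≤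
      LinearMap.range A.mulVecLin ⊔ LinearMap.range B.mulVecLin := by
    rintro _ ⟨x, rfl⟩
    exact Submodule.add_mem_sup ⟨x, rfl⟩ ⟨x, rfl⟩
  exact (Submodule.finrank_mono hle).trans (Submodule.finrank_add_le_finrank_add_finrank _ _)

/-- The rank of a `0/1` diagonal matrix is at most the number of ones. -/
theorem rank_diagonal_indicator_le (S : Finset (Fin m)) :
    (Matrix.diagonal fun a : Fin m => if a ∈ S then (1 : ℂ) else 0).rank ≤ S.card := by
  classical
  rw [Matrix.rank_diagonal, Fintype.card_subtype]
  refine le_of_eq (congrArg Finset.card ?_)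
  ext a
  simp only [Finset.mem_filter, Finset.mem_univ, true_and, ne_eq, ite_eq_right_iff, one_ne_zero,
    imp_false, not_not]

/-- **Rank bound on a compression space**: `u|_{R × C} = 0 ⇒ rank u ≤ 2m - |R| - |C|`. -/
theorem rank_le_of_mem_blockSpace {R C : Finset (Fin m)} {u : MatIdx m → ℂ} (hu : u ∈ blockSpace R C) :
    (Matrix.of fun a b : Fin m => u (toLex (a, b))).rank ≤ 2 * m - R.card - C.card := by
  classical
  set N : Matrix (Fin m) (Fin m) ℂ := Matrix.of fun a b : Fin m => u (toLex (a, b)) with hN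
  set D₁ : Matrix (Fin m) (Fin m) ℂ := Matrix.diagonal fun a => if a ∈ Rᶜ then (1 : ℂ) else 0 with hD₁
  set D₂ : Matrix (Fin m) (Fin m) ℂ := Matrix.diagonal fun b => if b ∈ Cᶜ then (1 : ℂ) else 0 with hD₂
  set E : Matrix (Fin m) (Fin m) ℂ := Matrix.diagonal fun a => if a ∈ R then (1 : ℂ) else 0 with hE
  have hdec : N = D₁ * N + E * N * D₂ := by
    ext a b
    simp only [Matrix.add_apply, hD₁, hD₂, hE, Matrix.diagonal_mul, Matrix.mul_diagonal, Finset.mem_compl]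
    by_cases ha : a ∈ R
    · by_cases hb : b ∈ C
      · have h0 : N a b = 0 := by rw [hN, Matrix.of_apply]; exact (mem_blockSpace_iff.mp hu) a ha b hb
        simp [h0]
      · simp [ha, hb]
    · simp [ha]
  have hR : R.card ≤ m := by simpa using R.card_le_univ
  have hC : C.card ≤ m := by simpa using C.card_le_univ
  calc N.rank = (D₁ * N + E * N * D₂).rank := by rw [← hdec]
    _ ≤ (D₁ * N).rank + (E * N * D₂).rank := rank_add_le' _ _
    _ ≤ D₁.rank + D₂.rank := add_le_add (Matrix.rank_mul_le_left _ _) (Matrix.rank_mul_le_right _ _)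
    _ ≤ Rᶜ.card + Cᶜ.card := add_le_add (rank_diagonal_indicator_le _) (rank_diagonal_indicator_le _)
    _ = 2 * m - R.card - C.card := by
        rw [Finset.card_compl, Finset.card_compl, Fintype.card_fin]; omega

/-- **The crux, instantiated at any compression space, is its own symmetric special case**: with
`U = blockSpace R C` and `r = 2m - |R| - |C|` the rank hypothesis holds and the right-hand side of
`ValuativeBound` is `finrank (symTruncation)` — the valuative clause is invisible there. -/
theorem valuativeBound_at_blockSpace_iff (R C : Finset (Fin m)) (δ : ℕ) (χ : Weight (MatIdx m)) (K : ℕ) :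
    ((∀ u ∈ blockSpace R C, (Matrix.of fun a b : Fin m => u (toLex (a, b))).rank ≤ 2 * m - R.card - C.card) →
      K ≤ Module.finrank ℂ (truncation m (rowLocus m (blockSpace R C))
        (δ * (m - (2 * m - R.card - C.card))) (m * δ) χ)) ↔
    K ≤ Module.finrank ℂ (symTruncation m (m * δ) χ) := by
  rw [truncation_blockSpace_cruxThreshold]
  exact ⟨fun h => h fun u hu => rank_le_of_mem_blockSpace hu, fun h _ => h⟩

end CompressionBlind

end Summit.ValiantsHypothesis.Theorems.ValuativeBoundNegative
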